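import Mathlib
import HarnessLib
import Summits.ResolutionOfSingularities.ResolutionOfSingularities.Theorems.WildQuotientsWildQuotientResolutionS1aKillFreeF
import Summits.ResolutionOfSingularities.ResolutionOfSingularities.Theorems.WildQuotientsWildQuotientResolutionS1aKillFreeAux

/-!
# S1a — K-FREE FRAME OF RECORD, producer tools I: finiteness of the carried formal locus, (F-T1) the `μ_F`-drop from an embedding missing a top component

[OURS · L1 W4.5c · lead-1 g11; R-F14/R-F14a, companion of `…S1aKillFreeF`] — NOT statements of the manuscript; counted 0; AI-level work, weaker than expert review.
Crux stmt-ResolutionOfSingularities-17941 `CyclicQuotientFourfolds`, line `s1a-logminvertex` v12. Route-independent.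

The producer of a `TreeF` (the A side of skeleton v12) must show its leaves `(N, 𝔅)` have LOWER `μ_F` than the root `(M, 𝔄)`. As for the typed twin ((T1) of
`…S1aKillFreeAux`) this is done by an EMBEDDING of carried formal loci `F_𝔅 ↪ F_𝔄` whose range misses a set containing a TOP component of `F_𝔄` (typically the aux
support; that it contains a top FORMAL component is the producer's OWN non-principality — provable).
* `noetherianSpace_fLocus`, `finite_irreducibleComponents_fLocus` (compact model);
* ★ `lexLTF_of_isEmbedding_missing_top` — **(F-T1)**;
* `lexLTF_trans`, `TreeF.trans` (grafting decorated trees), `lexLTF_of_fdim_lt` (a dimension drop suffices).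
* (appended, g11) ★ `lexLTF_of_fLocus_eq_empty` — (F-T0) the EMPTY LEAF (A-KF v1 (S1)/§1.4): `F_𝔅 = ∅`, `F_𝔄 ≠ ∅` ⇒ `LexLTF N 𝔅 M 𝔄`; `treeF_one_of_move_fLocus_eq_empty`.
-/

set_option linter.dupNamespace false

noncomputable section

open CategoryTheory Limits AlgebraicGeometry TopologicalSpace Topology
open Literature.AlgebraicGeometry.Resolution Literature.AlgebraicGeometry.RelativeSpec
open Summit.ResolutionOfSingularities.ResolutionOfSingularities.Theorems.WildQuotientResolution.S1
open Summit.ResolutionOfSingularities.ResolutionOfSingularities.Theorems.WildQuotientResolution.S1.NodeAtlas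
open Summit.ResolutionOfSingularities.ResolutionOfSingularities.Theorems.WildQuotientResolution.S1.CompCount
open Summit.ResolutionOfSingularities.ResolutionOfSingularities.Theorems.WildQuotientResolution.S1.NpFrame

namespace Summit.ResolutionOfSingularities.ResolutionOfSingularities.Theorems.WildQuotientResolution.S1.GameFrame.GModel

variable {p : ℕ} {X' X₁ : Scheme.{0}} {q : X' ⟶ X₁} {G : Type} [Group G] {ρ : G →* Aut X'} {g₀ : G}

/-- The carried formal locus of a quasi-compact model is a Noetherian space. -/
theorem noetherianSpace_fLocus (M : GModel p q G ρ g₀) [CompactSpace M.V] (𝔄 : NodeAtlasData p M.act g₀) : NoetherianSpace ↥𝔄.fLocus := by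
  haveI := M.isLocallyNoetherian
  haveI : IsNoetherian M.V := {}
  exact Topology.IsInducing.subtypeVal.noetherianSpace

/-- On a quasi-compact model the carried formal locus has finitely many irreducible components. -/
theorem finite_irreducibleComponents_fLocus (M : GModel p q G ρ g₀) [CompactSpace M.V] (𝔄 : NodeAtlasData p M.act g₀) :
    (irreducibleComponents ↥𝔄.fLocus).Finite := by
  haveI := M.noetherianSpace_fLocus 𝔄
  exact NoetherianSpace.finite_irreducibleComponents

/-- ★ **(F-T1)** An embedding `ψ : F_𝔅 → F_𝔄` of carried formal loci whose range is disjoint from a set `F` containing a TOP-dimensional component of `F_𝔄`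
forces `LexLTF N 𝔅 M 𝔄` (`M` compact with `dim F_𝔄` finite). [OURS · L1 W4.5c · R-F14] -/
theorem lexLTF_of_isEmbedding_missing_top (N : GModel p q G ρ g₀) (𝔅 : NodeAtlasData p N.act g₀) (M : GModel p q G ρ g₀) [CompactSpace M.V]
    (𝔄 : NodeAtlasData p M.act g₀) {n : ℕ} (hdim : M.fdim 𝔄 < n)
    (ψ : ↥𝔅.fLocus → ↥𝔄.fLocus) (hψ : IsEmbedding ψ) {F : Set ↥𝔄.fLocus} (hF : Disjoint (Set.range ψ) F)
    {t : Set ↥𝔄.fLocus} (ht : t ∈ irreducibleComponents ↥𝔄.fLocus) (hdt : topologicalKrullDim ↥t = M.fdim 𝔄) (htF : t ⊆ F) :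
    LexLTF N 𝔅 M 𝔄 := by
  have hle : N.fdim 𝔅 ≤ M.fdim 𝔄 := hψ.isInducing.topologicalKrullDim_le
  rcases hle.lt_or_eq with hlt | heq
  · exact Or.inl hlt
  have hbot : M.fdim 𝔄 ≠ ⊥ := by
    intro hbot
    rw [fdim, topologicalKrullDim, Order.krullDim_eq_bot_iff] at hbot
    obtain ⟨x, -⟩ := ht.1.nonempty
    exact hbot.elim ⟨closure {x}, isIrreducible_singleton.closure, isClosed_closure⟩
  obtain ⟨k, hk⟩ := exists_nat_eq_of_ne_bot_of_lt hbot hdim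
  exact Or.inr ⟨heq, Or.inl (TopCount.nTopComp_lt_of_isEmbedding hψ hk (heq.trans hk) (M.finite_irreducibleComponents_fLocus 𝔄) hF ht
    (hdt.trans hk) htF)⟩

/-- A strict DIMENSION drop suffices for `LexLTF`. -/
theorem lexLTF_of_fdim_lt {N : GModel p q G ρ g₀} {𝔅 : NodeAtlasData p N.act g₀} {M : GModel p q G ρ g₀} {𝔄 : NodeAtlasData p M.act g₀}
    (h : N.fdim 𝔅 < M.fdim 𝔄) : LexLTF N 𝔅 M 𝔄 :=
  Or.inl h

/-- Transitivity of `LexLTF`. -/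
theorem lexLTF_trans {A : GModel p q G ρ g₀} {𝔄 : NodeAtlasData p A.act g₀} {B : GModel p q G ρ g₀} {𝔅 : NodeAtlasData p B.act g₀}
    {C : GModel p q G ρ g₀} {ℭ : NodeAtlasData p C.act g₀} (h₁ : LexLTF A 𝔄 B 𝔅) (h₂ : LexLTF B 𝔅 C ℭ) : LexLTF A 𝔄 C ℭ := by
  rcases h₁ with a1 | ⟨a1, a2 | ⟨a2, a3⟩⟩ <;> rcases h₂ with b1 | ⟨b1, b2 | ⟨b2, b3⟩⟩
  · exact Or.inl (a1.trans b1)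
  · exact Or.inl (b1 ▸ a1)
  · exact Or.inl (b1 ▸ a1)
  · exact Or.inl (a1 ▸ b1)
  · exact Or.inr ⟨a1.trans b1, Or.inl (a2.trans b2)⟩
  · exact Or.inr ⟨a1.trans b1, Or.inl (b2 ▸ a2)⟩
  · exact Or.inl (a1 ▸ b1)
  · exact Or.inr ⟨a1.trans b1, Or.inl (a2 ▸ b2)⟩
  · exact Or.inr ⟨a1.trans b1, Or.inr ⟨a2.trans b2, a3.trans b3⟩⟩

/-- **Grafting decorated trees**: a tree of depth `≤ n` whose leaves carry trees of depth `≤ m` with leaves in `Q'` is a tree of depth `≤ n + m`. -/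
theorem TreeF.trans {P Q Q' : ∀ M : GModel p q G ρ g₀, NodeAtlasData p M.act g₀ → Prop} {m : ℕ}
    (hQ : ∀ (N : GModel p q G ρ g₀) (𝔅 : NodeAtlasData p N.act g₀), Q N 𝔅 → TreeF P Q' m N 𝔅) :
    ∀ (n : ℕ) (M : GModel p q G ρ g₀) (𝔄 : NodeAtlasData p M.act g₀), TreeF P Q n M 𝔄 → TreeF P Q' (n + m) M 𝔄
  | 0, M, 𝔄, h => by rw [Nat.zero_add]; exact hQ M 𝔄 h
  | n + 1, M, 𝔄, h => by
      rcases h with h | ⟨𝔄', hP, ht⟩ | ⟨𝒦, d, hadm, hmv⟩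
      · exact TreeF.mono M 𝔄 (by omega) (hQ M 𝔄 h)
      · rw [Nat.add_right_comm]
        exact Or.inr (Or.inl ⟨𝔄', hP, TreeF.trans hQ n M 𝔄' ht⟩)
      · rw [Nat.add_right_comm]
        refine Or.inr (Or.inr ⟨𝒦, d, hadm, fun M' hm => ?_⟩)
        obtain ⟨𝔄', hP, ht⟩ := hmv M' hm
        exact ⟨𝔄', hP, TreeF.trans hQ n M' 𝔄' ht⟩

/-- ★ **(F-T0) THE EMPTY LEAF**: a decorated model whose carried formal locus is EMPTY is `μ_F`-below every decorated model whose carried formal locus is not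
(`fdim = ⊥ < fdim ≥ 0`). The leaf lemma of every census master tree under the X-scheme (A-KF v1 §1.4/(S1)). [OURS · L1 W4.5c · R-F14] -/
theorem lexLTF_of_fLocus_eq_empty (N : GModel p q G ρ g₀) (𝔅 : NodeAtlasData p N.act g₀) (M : GModel p q G ρ g₀) (𝔄 : NodeAtlasData p M.act g₀)
    (h : 𝔅.fLocus = ∅) (h' : 𝔄.fLocus.Nonempty) : LexLTF N 𝔅 M 𝔄 := by
  refine Or.inl ?_
  have hbot : N.fdim 𝔅 = ⊥ := by
    rw [fdim, topologicalKrullDim, Order.krullDim_eq_bot_iff]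
    constructor
    rintro ⟨Z, hZ, -⟩
    obtain ⟨z, -⟩ := hZ.nonempty
    have hz : (z : N.V) ∈ (∅ : Set N.V) := h ▸ z.2
    exact hz
  have hnn : (0 : WithBot ℕ∞) ≤ M.fdim 𝔄 := by
    obtain ⟨x, hx⟩ := h'
    haveI : Nonempty (TopologicalSpace.IrreducibleCloseds ↥𝔄.fLocus) :=
      ⟨⟨closure {(⟨x, hx⟩ : ↥𝔄.fLocus)}, isIrreducible_singleton.closure, isClosed_closure⟩⟩
    exact Order.krullDim_nonneg
  rw [hbot]
  exact lt_of_lt_of_le (WithBot.bot_lt_coe (0 : ℕ∞)) hnn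

/-- (F-T0) in tree form: a MOVE all of whose decorated realisations have EMPTY carried formal locus is a depth-1 `TreeF` node below a model with non-empty formal locus. -/
theorem treeF_one_of_move_fLocus_eq_empty {P : ∀ N : GModel p q G ρ g₀, NodeAtlasData p N.act g₀ → Prop} (M : GModel p q G ρ g₀) (𝔄 : NodeAtlasData p M.act g₀)
    (h' : 𝔄.fLocus.Nonempty) (𝒦 : ReesFiltration M.V) (d : ℕ) (hadm : IsAdmissibleCentre p M.act g₀ 𝒦 d)
    (hdec : ∀ M' : GModel p q G ρ g₀, M.IsMoveOf M' 𝒦 d → ∃ 𝔄' : NodeAtlasData p M'.act g₀, P M' 𝔄' ∧ 𝔄'.fLocus = ∅) :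
    TreeF P (fun N 𝔅 => LexLTF N 𝔅 M 𝔄) 1 M 𝔄 := by
  refine Or.inr (Or.inr ⟨𝒦, d, hadm, fun M' hm => ?_⟩)
  obtain ⟨𝔄', hP, he⟩ := hdec M' hm
  exact ⟨𝔄', hP, M'.lexLTF_of_fLocus_eq_empty 𝔄' M 𝔄 he h'⟩

end Summit.ResolutionOfSingularities.ResolutionOfSingularities.Theorems.WildQuotientResolution.S1.GameFrame.GModel

end
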